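import Mathlib
import Summits.NavierStokesRegularity.NavierStokesRegularity.Theorems.ThreadingFluxHorizonTowerFiniteTowerClassPoly
import HarnessLib

/-!
# Crux `PoloidalLiouville` (stmt-NavierStokesRegularity-1222), crux idea «horizon-threading-tower» (ns-idea-15):
# FINITE TOWERS AT ORDER ONE — THE TOP PAIR OF THE CLASS POLYNOMIAL MODULO `ρ²`

Support file (`--supports stmt-NavierStokesRegularity-1222`, helper; cell `ns-wall-extremal`, width hand ns-wall-eng-3 g5; 0 kit), toward
THM H «second cone digit for quadratic generators».

★ `finiteTower_topPair_mod_normSq_sq`: in a finite scale-free tower annihilated by the order-one horizon law off the centre, with top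
pair `D′ < D`, `D′ + 2 ≤ D`, and NO shell of degree `D′ − 2`, the class polynomial of level `N = D + D′` (which vanishes,
`finiteTower_classPoly_eq_zero`) has no term on level `N − 2`, so
`2 (D′(D′+1) − D(D+1)) · {P_{D′}, P_D} + ρ² · R = 0` for some polynomial `R`:
the competitors of the top pair enter only at the THIRD `ρ`-adic digit.

HONEST LABEL: bookkeeping about one crux idea's typed objects; no Prop of the sketch is closed here; `HorizonTowerZonality` (general
towers), `PoloidalLiouville` (1222) OPEN; NS regularity NOT proved.  [folklore]
-/

-- the summit and its single sub-problem share the name (CONVENTIONS §1)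
set_option linter.dupNamespace false

noncomputable section

open MvPolynomial
open scoped RealInnerProductSpace

namespace Summit.NavierStokesRegularity.NavierStokesRegularity.Theorems.PoloidalLiouville.HorizonTower

section FiniteTower

variable (K : Finset ℕ) (H : ℕ → E3 → ℝ)

/-- ★ **THE TOP PAIR MODULO `ρ²`.**  With top pair `D′ < D` (`D′ + 2 ≤ D`) and no shell of degree `D′ − 2`, the class identity of a
finite tower passing order one reads `2(D′(D′+1) − D(D+1)) · detP P_{D′} P_D + ρ² · R = 0` for some polynomial `R`. [folklore] -/
theorem finiteTower_topPair_mod_normSq_sq (hK : ∀ l ∈ K, 1 ≤ l) (hH : ∀ l ∈ K, ContDiff ℝ (⊤ : ℕ∞) (H l))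
    (hhom : ∀ l ∈ K, ∀ (c : ℝ) (y : E3), H l (c • y) = c ^ l * H l y)
    (hharm : ∀ l ∈ K, ∀ y, Laplacian.laplacian (H l) y = 0)
    (hL1 : ∀ x : E3, x ≠ 0 → horizonL1 (fun z => ∑ l ∈ K, horizonProfile l (H l) 0 z) 0 x = 0)
    (P : ℕ → MvPolynomial (Fin 3) ℝ) (hP : ∀ l ∈ K, ∀ y, H l y = Zonal.evalE (P l) y)
    {D D' : ℕ} (hD : D ∈ K) (hD' : D' ∈ K) (hDD : D' + 2 ≤ D) (hmax : ∀ l ∈ K, l ≤ D) (hsec : ∀ l ∈ K, l ≠ D → l ≤ D')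
    (hgap : ∀ l ∈ K, l + 2 ≠ D') :
    ∃ R : MvPolynomial (Fin 3) ℝ,
      C (2 * ((D' : ℝ) * (D' + 1) - (D : ℝ) * (D + 1))) * Zonal.detP (P D') (P D) + Zonal.normSq ^ 2 * R = 0 := by
  classical
  set N : ℕ := D + D' with hN
  set ρ : MvPolynomial (Fin 3) ℝ := X 0 ^ 2 + X 1 ^ 2 + X 2 ^ 2 with hρ
  have hρeq : (Zonal.normSq : MvPolynomial (Fin 3) ℝ) = ρ := rfl
  -- the class polynomial vanishes
  have hQ := finiteTower_classPoly_eq_zero K H hK hH hhom hharm hL1 P hP N (by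
    intro j hj k hk hjk
    have hjD := hmax j hj
    have hkD := hmax k hk
    have : j = D ∧ k = D := by
      constructor
      · by_contra h; have := hsec j hj h; omega
      · by_contra h; have := hsec k hk h; omega
    rw [this.1, this.2, Zonal.detP_self'])
  -- termwise decomposition: top pair + ρ² · rest
  set t : ℕ → ℕ → MvPolynomial (Fin 3) ℝ := fun j k =>
    if j + k ≤ N ∧ (j + k) % 2 = N % 2 then
      C ((j : ℝ) * (j + 1) - (k : ℝ) * (k + 1)) * (ρ ^ ((N - (j + k)) / 2) * Zonal.detP (P j) (P k)) else 0 with ht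
  set top : ℕ → ℕ → MvPolynomial (Fin 3) ℝ := fun j k =>
    if j = D' ∧ k = D then C (((D' : ℝ) * (D' + 1) - (D : ℝ) * (D + 1))) * Zonal.detP (P D') (P D)
    else if j = D ∧ k = D' then C (((D : ℝ) * (D + 1) - (D' : ℝ) * (D' + 1))) * Zonal.detP (P D) (P D') else 0 with htop
  set r : ℕ → ℕ → MvPolynomial (Fin 3) ℝ := fun j k =>
    if j + k + 4 ≤ N ∧ (j + k) % 2 = N % 2 then
      C ((j : ℝ) * (j + 1) - (k : ℝ) * (k + 1)) * (ρ ^ ((N - (j + k)) / 2 - 2) * Zonal.detP (P j) (P k)) else 0 with hr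
  have hterm : ∀ j ∈ K, ∀ k ∈ K, t j k = top j k + ρ ^ 2 * r j k := by
    intro j hj k hk
    have hjD := hmax j hj
    have hkD := hmax k hk
    simp only [ht, htop, hr]
    by_cases hcond : j + k ≤ N ∧ (j + k) % 2 = N % 2
    · rw [if_pos hcond]
      rcases Nat.lt_or_ge (j + k + 3) N with hlow | hhigh
      · -- `j + k + 4 ≤ N`
        have h4 : j + k + 4 ≤ N := by omega
        have hne1 : ¬(j = D' ∧ k = D) := by rintro ⟨rfl, rfl⟩; omega
        have hne2 : ¬(j = D ∧ k = D') := by rintro ⟨rfl, rfl⟩; omega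
        rw [if_neg hne1, if_neg hne2, if_pos ⟨h4, hcond.2⟩, zero_add]
        obtain ⟨e, he⟩ : ∃ e, (N - (j + k)) / 2 = e + 2 := ⟨(N - (j + k)) / 2 - 2, by omega⟩
        rw [he, Nat.add_sub_cancel, pow_add]
        ring
      · -- `j + k ≥ N − 3`: by parity `j + k = N` or `j + k = N − 2`
        have hr0 : ¬(j + k + 4 ≤ N ∧ (j + k) % 2 = N % 2) := fun h => by omega
        rw [if_neg hr0, mul_zero, add_zero]
        rcases Nat.lt_or_ge (j + k) N with hlt | hge
        · -- `j + k = N − 2`: no such pair contributes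
          have hsum : j + k + 2 = N := by omega
          have hne1 : ¬(j = D' ∧ k = D) := by rintro ⟨rfl, rfl⟩; omega
          have hne2 : ¬(j = D ∧ k = D') := by rintro ⟨rfl, rfl⟩; omega
          rw [if_neg hne1, if_neg hne2]
          -- either a shell of degree `D′ − 2` (excluded) or `j = k = D′`
          rcases eq_or_ne k D with rfl | hkne
          · exact absurd (by omega : j + 2 = D') (hgap j hj)
          rcases eq_or_ne j D with rfl | hjne
          · exact absurd (by omega : k + 2 = D') (hgap k hk)
          have hj' := hsec j hj hjne
          have hk' := hsec k hk hkne
          have hjk : j = D' ∧ k = D' := by omega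
          rw [hjk.1, hjk.2, sub_self, C_0, zero_mul]
        · -- `j + k = N`: the top pair
          have hsum : j + k = N := le_antisymm hcond.1 hge
          rcases eq_or_ne k D with rfl | hkne
          · have hj' : j = D' := by omega
            subst hj'
            rw [if_pos ⟨rfl, rfl⟩, show (N - (j + k)) / 2 = 0 by omega, pow_zero, one_mul]
          · have hk' := hsec k hk hkne
            have hjD2 : j = D := by omega
            have hkD2 : k = D' := by omega
            subst hjD2; subst hkD2
            have hne1 : ¬(j = k ∧ k = j) := by rintro ⟨rfl, -⟩; omega
            rw [if_neg hne1, if_pos ⟨rfl, rfl⟩, show (N - (j + k)) / 2 = 0 by omega, pow_zero, one_mul]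
    · rw [if_neg hcond]
      have hne1 : ¬(j = D' ∧ k = D) := by rintro ⟨rfl, rfl⟩; exact hcond ⟨by omega, by omega⟩
      have hne2 : ¬(j = D ∧ k = D') := by rintro ⟨rfl, rfl⟩; exact hcond ⟨by omega, by rw [hN, add_comm]⟩
      have hr0 : ¬(j + k + 4 ≤ N ∧ (j + k) % 2 = N % 2) := fun h => hcond ⟨by omega, h.2⟩
      rw [if_neg hne1, if_neg hne2, if_neg hr0, mul_zero, add_zero]
  -- sum it up
  have hsplit : (∑ j ∈ K, ∑ k ∈ K, t j k) = (∑ j ∈ K, ∑ k ∈ K, top j k) + ρ ^ 2 * ∑ j ∈ K, ∑ k ∈ K, r j k := by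
    rw [Finset.mul_sum, ← Finset.sum_add_distrib]
    refine Finset.sum_congr rfl fun j hj => ?_
    rw [Finset.mul_sum, ← Finset.sum_add_distrib]
    exact Finset.sum_congr rfl fun k hk => hterm j hj k hk
  have htopsum : (∑ j ∈ K, ∑ k ∈ K, top j k)
      = C (2 * ((D' : ℝ) * (D' + 1) - (D : ℝ) * (D + 1))) * Zonal.detP (P D') (P D) := by
    have hne : D' ≠ D := by omega
    rw [← Finset.sum_product' K K (fun j k => top j k)]
    rw [Finset.sum_eq_add_of_mem (D', D) (D, D') (Finset.mk_mem_product hD' hD) (Finset.mk_mem_product hD hD')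
        (by simp [Prod.ext_iff, hne]) ?_]
    · have t1 : top D' D = C (((D' : ℝ) * (D' + 1) - (D : ℝ) * (D + 1))) * Zonal.detP (P D') (P D) := by
        simp [htop]
      have t2 : top D D' = C (((D : ℝ) * (D + 1) - (D' : ℝ) * (D' + 1))) * Zonal.detP (P D) (P D') := by
        simp [htop, hne.symm]
      rw [t1, t2, Zonal.detP_antisymm (P D') (P D)]
      simp only [map_mul, map_sub, map_add, map_natCast, map_one, map_ofNat]
      ring
    · rintro ⟨j, k⟩ - ⟨h1, h2⟩
      simp only [htop]
      rw [if_neg (fun h => h1 (Prod.ext h.1 h.2)), if_neg (fun h => h2 (Prod.ext h.1 h.2))]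
  refine ⟨∑ j ∈ K, ∑ k ∈ K, r j k, ?_⟩
  have h0 : (∑ j ∈ K, ∑ k ∈ K, t j k) = 0 := hQ
  rw [hsplit, htopsum] at h0
  rw [hρeq]
  exact h0

end FiniteTower

end Summit.NavierStokesRegularity.NavierStokesRegularity.Theorems.PoloidalLiouville.HorizonTower

end
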